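import Summits.MatrixMultiplication.MatrixMultiplication.Theorems.SoloBlindKirillovIsotropy

/-!
# Solo-blind seat, s15 anchor 4: the slices of an isotropic hyperplane pair fill the radical

Companion to `paper/LieExponent.md` §3.22, THEOREM 9(ii) (solo-blind seat `solo-MatrixMultiplication-blind`).

Setting of Theorem 9: `μ ∈ 𝔤*`, `V = ker μ`, `B = ω_μ|_V` (reflexive, indeed alternating), radical
`R' = ker B` of dimension `a`, `ρ = dim V − a`.  Two Lie subalgebras `𝔥₂, 𝔥₃ ⊂ ker μ` are `B`-isotropic
(`[𝔥,𝔥] ⊂ 𝔥 ⊂ ker μ`), and so is the right-trivialised tangent space `U₁` of a submanifold pinned to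
`α_μ = 0` (Maurer–Cartan).  The linear-algebra heart of Theorem 9(ii), kernel-checked here over any field:

* `soloLie_slices_fill_radical` — if two isotropic subspaces `U₂, U₃` have
  `dim U₂ + dim U₃ ≥ dim V` (a hyperplane pair: `𝔥₂ ⊕ 𝔥₃ = ker μ`), then their SLICES
  `U_i ∩ rad B` have total dimension `≥ dim rad B = a`: the two subgroup slices already fill the
  characteristic group `A`;
* `soloLie_thm9_slice_count` — if moreover a third isotropic subspace `U₁` meets the radical
  trivially (its slice is finite, which is what Lemma 2.1 inside `A` forces once the other two slices
  fill `A`), then `2 · dim U₁ ≤ dim V − a = ρ`, i.e. `dim M₁ ≤ ρ/2`.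

Both are two-line consequences of `soloLie_isotropic_finrank_bound` (anchor of §3.17, same directory).
-/

set_option linter.dupNamespace false

namespace Summit.MatrixMultiplication.MatrixMultiplication.Theorems

open Module

variable {K V : Type*} [Field K] [AddCommGroup V] [Module K V] [FiniteDimensional K V]

/-- THE SLICES OF AN ISOTROPIC HYPERPLANE PAIR FILL THE RADICAL (LieExponent §3.22, Theorem 9(ii)).
For a reflexive bilinear form `B` on `V` and totally isotropic subspaces `U₂, U₃` with
`dim U₂ + dim U₃ ≥ dim V`:  `dim (ker B) ≤ dim (U₂ ∩ ker B) + dim (U₃ ∩ ker B)`. -/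
theorem soloLie_slices_fill_radical (B : LinearMap.BilinForm K V) (hB : B.IsRefl)
    (U₂ U₃ : Submodule K V)
    (h₂ : ∀ x ∈ U₂, ∀ y ∈ U₂, B x y = 0) (h₃ : ∀ x ∈ U₃, ∀ y ∈ U₃, B x y = 0)
    (hspan : finrank K V ≤ finrank K U₂ + finrank K U₃) :
    finrank K (LinearMap.ker B) ≤
      finrank K (U₂ ⊓ LinearMap.ker B : Submodule K V) +
        finrank K (U₃ ⊓ LinearMap.ker B : Submodule K V) := by
  have e₂ := soloLie_isotropic_finrank_bound B hB U₂ h₂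
  have e₃ := soloLie_isotropic_finrank_bound B hB U₃ h₃
  omega

/-- THEOREM 9(ii) COUNT.  If, in the situation of `soloLie_slices_fill_radical`, a third totally
isotropic subspace `U₁` meets the radical trivially (`U₁ ∩ ker B = 0` — the third slice is finite),
then `2 · dim U₁ + dim (ker B) ≤ dim V`, i.e. `dim U₁ ≤ ρ/2` with `ρ = dim V − dim rad B`; and the two
slices of the pair fill the radical. -/
theorem soloLie_thm9_slice_count (B : LinearMap.BilinForm K V) (hB : B.IsRefl)
    (U₁ U₂ U₃ : Submodule K V)
    (h₁ : ∀ x ∈ U₁, ∀ y ∈ U₁, B x y = 0) (h₂ : ∀ x ∈ U₂, ∀ y ∈ U₂, B x y = 0)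
    (h₃ : ∀ x ∈ U₃, ∀ y ∈ U₃, B x y = 0)
    (hspan : finrank K V ≤ finrank K U₂ + finrank K U₃)
    (hS₁ : (U₁ ⊓ LinearMap.ker B : Submodule K V) = ⊥) :
    2 * finrank K U₁ + finrank K (LinearMap.ker B) ≤ finrank K V ∧
      finrank K (LinearMap.ker B) ≤
        finrank K (U₂ ⊓ LinearMap.ker B : Submodule K V) +
          finrank K (U₃ ⊓ LinearMap.ker B : Submodule K V) := by
  refine ⟨?_, soloLie_slices_fill_radical B hB U₂ U₃ h₂ h₃ hspan⟩
  have e₁ := soloLie_isotropic_finrank_bound B hB U₁ h₁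
  have h0 : finrank K (U₁ ⊓ LinearMap.ker B : Submodule K V) = 0 := by
    rw [hS₁, finrank_bot]
  omega

end Summit.MatrixMultiplication.MatrixMultiplication.Theorems
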